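/-
Origin: expansion seat `planner-pub-hodgecm-mc-axioms-1-g14-0`, handover #W35 2026-08-20T15:53:55Z md5 c7d844ae7d15 (PKG a94ce64f74cc → c7d844ae7d15; 88 l.; MECHANICAL (iib-R) rewrite v3.1 of the PKG file as it stands (85 token edits; rules R1x1+RX[h₂]x84)) (`HOME/mc/pub-hodgecm-mc-axioms-1-g14/revendor/kit-r55/stage55/HodgeCM/Model/E2InstanceOR21AEI.lean`, md5 c7d844ae7d15, 88 lines);
landed by the gen-22 packager (p-g22) in gate run 55 REPLACES the earlier landed copy of `HodgeCM/Model/E2InstanceOR21AEI.lean` (seat copy carried the packager Origin header of an earlier run (stripped)).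
-/
/-
Origin: glue-1 lane, seat `planner-pub-hodgecm-mc-glue-1-g9-0` (unit pub-hodgecm-mc-glue-1-g9), 2026-08-20 — item (ORIENT-h): the E term of the
oriented family INSTANTIATED at the bit of record `orientBitι` (carch-1 #CA16).  ADDITIVE LEAF over `E2InstanceOR21AE` + `ArchKTypeOfOrient`;
one application, no new definitions, records or cites; closure = standard trio.
-/
import Summits.HodgeConjecture.HodgeCM.Model.E2InstanceOR21AE
import Summits.HodgeConjecture.HodgeCM.Model.ArchKTypeOfOrient

/-! PORT of `HodgeCM/Model/E2InstanceOR21AEI.lean` (HodgeCMPerL run 82) — verbatim mechanical port; provenance in the PORT header line. -/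

noncomputable section

open scoped TensorProduct InnerProductSpace Matrix

namespace HodgeCM

namespace Model

open HodgeCM.Universe (AdelicThetaCore AdelicThetaCore₀ SideData ThetaModel ModelAxiomsPerL)
open Literature.AlgebraicGeometry.HodgeTheory
open Literature.AlgebraicGeometry.ComplexMultiplication (Shimura1998_Thm3_isogenousPower Shimura1998_Thm2_Cor)
open Literature.NumberTheory.Automorphic.PicardCM
open Literature.NumberTheory.Transcendental (Arapura2012_Cor_15_4_6)
open HodgeCM.CMTypeOps (inflate)
open HodgeCM.Model.SupplyResidual (ClassSupplyPackN)
open HodgeCM.Model.ThetaSpace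

variable (hHD : exists_isReal_hodgeModel) (hI : hodgePQ_independent_of_hodgeModel)
  (h₁ : BallQuotientUniformised)  (h₃ : CMAbelianVarietyEigenbasisRealised)

/-- **E term at the BIT OF RECORD** (item (ORIENT-h), rulings lead 1-g59 STATUS 2026-08-20 l.12517 (R2) /
l.12532 (S3)(b); bit of record `orientBitι L ι₁ := decide ((ι₁ (imagUnit L)).im < 0)`, carch-1 `Model/ArchKTypeOfOrient`
#CA16): `perL_picardCM_r21AEO` instantiated at `hb := orientBitι`.  The recipe bit is no longer a parameter: at every target
embedding `ι₁` the sign recipe is read through `ι₁` itself, so that `s = +` holds in `GoodCtx` at BOTH embeddings over each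
complex place (`orientBitι_conjugate`).  14 explicit binder groups = `_r21AEO`'s groups 2–15 with `hb L ι₁ ↦ orientBitι L ι₁`
(group 1 discharged by definition); conclusion unchanged. -/
theorem perL_picardCM_r21AEI (hA : Arapura2012_Cor_15_4_6)
    (W : ∀ {L : CMField} {ι₁ : L →+* ℂ} (V : HermSpace3 L ι₁) (c : SeesawCtx L), WmInput V c.D)
    (S : ∀ {L : CMField} {ι₁ : L →+* ℂ} (V : HermSpace3 L ι₁) (c : SeesawCtx L), ThetaAdelicSide V c)
    (μ : ∀ {L : CMField}, SeesawCtx L → Fin 4 → NumberField.InfinitePlace L → ℤ)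
    (hR : DeligneMilne1982_Thm_6_20_full)
    (hΘ : ∀ {L : CMField} {ι₁ : L →+* ℂ} (V : HermSpace3 L ι₁) (c : SeesawCtx L),
      (thetaModelOf hHD hI h₁ (cmAbelianVarietyRealised_of_eigenbasis hHD hI h₃) (orientBitι L ι₁) (embOf hHD hI h₁ (cmAbelianVarietyRealised_of_eigenbasis hHD hI h₃)) (coverOf hHD hI h₁ (cmAbelianVarietyRealised_of_eigenbasis hHD hI h₃) hA) (wmOfInput W) (thetaOf _ (thetaClassInputOf _ (fun V c => thetaSpaceInputOf hHD hI h₁ (cmAbelianVarietyRealised_of_eigenbasis hHD hI h₃) S V c))) (d12Of μ) (d34Of μ)).GoodCtx ι₁ c → Module.finrank ℚ c.K = 6 →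
      ∀ i : Fin 4, ∃ Γ₀ : Level V, ∀ Γ ≤ Γ₀,
        ∃ D : CommonReflexInput c.K (c.Ψ i) c.σ,
          (thetaModelOf hHD hI h₁ (cmAbelianVarietyRealised_of_eigenbasis hHD hI h₃) (orientBitι L ι₁) (embOf hHD hI h₁ (cmAbelianVarietyRealised_of_eigenbasis hHD hI h₃)) (coverOf hHD hI h₁ (cmAbelianVarietyRealised_of_eigenbasis hHD hI h₃) hA) (wmOfInput W) (thetaOf _ (thetaClassInputOf _ (fun V c => thetaSpaceInputOf hHD hI h₁ (cmAbelianVarietyRealised_of_eigenbasis hHD hI h₃) S V c))) (d12Of μ) (d34Of μ)).Theta V c i Γ ⊆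
            Submodule.span ℂ (D.surfaceClasses hHD hI h₁ (cmAbelianVarietyRealised_of_eigenbasis hHD hI h₃) V Γ))
    (C : ∀ {L : CMField} {ι₁ : L →+* ℂ} (V : HermSpace3 L ι₁) (c : SeesawCtx L) (hV : IsAnisotropic L V.Hm),
      (thetaModelOf hHD hI h₁ (cmAbelianVarietyRealised_of_eigenbasis hHD hI h₃) (orientBitι L ι₁) (embOf hHD hI h₁ (cmAbelianVarietyRealised_of_eigenbasis hHD hI h₃)) (coverOf hHD hI h₁ (cmAbelianVarietyRealised_of_eigenbasis hHD hI h₃) hA) (wmOfInput W) (thetaOf _ (thetaClassInputOf _ (fun V c => thetaSpaceInputOf hHD hI h₁ (cmAbelianVarietyRealised_of_eigenbasis hHD hI h₃) S V c))) (d12Of μ) (d34Of μ)).GoodCtx ι₁ c →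
      Module.finrank ℚ c.K = 6 → ∀ k : Fin 4, k = 0 ∨ k = 1 → ∀ N : ℕ, 0 < N →
        ArchKTypeData (thetaSpaceInputIn hHD hI h₁ (cmAbelianVarietyRealised_of_eigenbasis hHD hI h₃) (S V c) hV) k N)
    (hT : ∀ {L : CMField} {ι₁ : L →+* ℂ} (V : HermSpace3 L ι₁) (c : SeesawCtx L) (k : Fin 4) (N : ℕ),
      ((S V c).P k).IsThetaArchContinuous N)
    (hpd : ∀ {L : CMField} {ι₁ : L →+* ℂ} (V : HermSpace3 L ι₁) (c : SeesawCtx L) (hV : IsAnisotropic L V.Hm)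
      (hc : (thetaModelOf hHD hI h₁ (cmAbelianVarietyRealised_of_eigenbasis hHD hI h₃) (orientBitι L ι₁) (embOf hHD hI h₁ (cmAbelianVarietyRealised_of_eigenbasis hHD hI h₃)) (coverOf hHD hI h₁ (cmAbelianVarietyRealised_of_eigenbasis hHD hI h₃) hA) (wmOfInput W) (thetaOf _ (thetaClassInputOf _ (fun V c => thetaSpaceInputOf hHD hI h₁ (cmAbelianVarietyRealised_of_eigenbasis hHD hI h₃) S V c))) (d12Of μ) (d34Of μ)).GoodCtx ι₁ c)
      (h6 : Module.finrank ℚ c.K = 6) (k : Fin 4) (hk : k = 0 ∨ k = 1) (N : ℕ) (hN : 0 < N),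
      (C V c hV hc h6 k hk N hN).IsWeaklyPDiff Literature.AlgebraicGeometry.ShimuraVarieties.BallForms.expP)
    (hk : ∀ {L : CMField} {ι₁ : L →+* ℂ} (V : HermSpace3 L ι₁) (c : SeesawCtx L) (hV : IsAnisotropic L V.Hm)
      (hc : (thetaModelOf hHD hI h₁ (cmAbelianVarietyRealised_of_eigenbasis hHD hI h₃) (orientBitι L ι₁) (embOf hHD hI h₁ (cmAbelianVarietyRealised_of_eigenbasis hHD hI h₃)) (coverOf hHD hI h₁ (cmAbelianVarietyRealised_of_eigenbasis hHD hI h₃) hA) (wmOfInput W) (thetaOf _ (thetaClassInputOf _ (fun V c => thetaSpaceInputOf hHD hI h₁ (cmAbelianVarietyRealised_of_eigenbasis hHD hI h₃) S V c))) (d12Of μ) (d34Of μ)).GoodCtx ι₁ c)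
      (h6 : Module.finrank ℚ c.K = 6) (k : Fin 4) (hk : k = 0 ∨ k = 1) (N : ℕ) (hN : 0 < N) (p : Fin 2),
      (C V c hV hc h6 k hk N hN).IsPMinusKilledAlong Literature.AlgebraicGeometry.ShimuraVarieties.BallForms.expP
        (-Complex.I • (Pi.single p 1 : Fin 2 → ℂ)))
    (gen12 : ∀ {L : CMField} {ι₁ : L →+* ℂ} (V : HermSpace3 L ι₁) (c : SeesawCtx L),
      (thetaModelOf hHD hI h₁ (cmAbelianVarietyRealised_of_eigenbasis hHD hI h₃) (orientBitι L ι₁) (embOf hHD hI h₁ (cmAbelianVarietyRealised_of_eigenbasis hHD hI h₃)) (coverOf hHD hI h₁ (cmAbelianVarietyRealised_of_eigenbasis hHD hI h₃) hA) (wmOfInput W) (thetaOf _ (thetaClassInputOf _ (fun V c => thetaSpaceInputOf hHD hI h₁ (cmAbelianVarietyRealised_of_eigenbasis hHD hI h₃) S V c))) (d12Of μ) (d34Of μ)).GoodCtx ι₁ c → Module.finrank ℚ c.K = 6 →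
      Nonempty ((thetaModelOf hHD hI h₁ (cmAbelianVarietyRealised_of_eigenbasis hHD hI h₃) (orientBitι L ι₁) (embOf hHD hI h₁ (cmAbelianVarietyRealised_of_eigenbasis hHD hI h₃)) (coverOf hHD hI h₁ (cmAbelianVarietyRealised_of_eigenbasis hHD hI h₃) hA) (wmOfInput W) (thetaOf _ (thetaClassInputOf _ (fun V c => thetaSpaceInputOf hHD hI h₁ (cmAbelianVarietyRealised_of_eigenbasis hHD hI h₃) S V c))) (d12Of μ) (d34Of μ)).Gen12FunBridge V c))
    (real34 : ∀ {L : CMField} {ι₁ : L →+* ℂ} (V : HermSpace3 L ι₁) (c : SeesawCtx L),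
      (thetaModelOf hHD hI h₁ (cmAbelianVarietyRealised_of_eigenbasis hHD hI h₃) (orientBitι L ι₁) (embOf hHD hI h₁ (cmAbelianVarietyRealised_of_eigenbasis hHD hI h₃)) (coverOf hHD hI h₁ (cmAbelianVarietyRealised_of_eigenbasis hHD hI h₃) hA) (wmOfInput W) (thetaOf _ (thetaClassInputOf _ (fun V c => thetaSpaceInputOf hHD hI h₁ (cmAbelianVarietyRealised_of_eigenbasis hHD hI h₃) S V c))) (d12Of μ) (d34Of μ)).GoodCtx ι₁ c → Module.finrank ℚ c.K = 6 →
      Nonempty ((thetaModelOf hHD hI h₁ (cmAbelianVarietyRealised_of_eigenbasis hHD hI h₃) (orientBitι L ι₁) (embOf hHD hI h₁ (cmAbelianVarietyRealised_of_eigenbasis hHD hI h₃)) (coverOf hHD hI h₁ (cmAbelianVarietyRealised_of_eigenbasis hHD hI h₃) hA) (wmOfInput W) (thetaOf _ (thetaClassInputOf _ (fun V c => thetaSpaceInputOf hHD hI h₁ (cmAbelianVarietyRealised_of_eigenbasis hHD hI h₃) S V c))) (d12Of μ) (d34Of μ)).Real34FunBridge V c))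
    (hyp12 : ∀ {L : CMField} {ι₁ : L →+* ℂ} (V : HermSpace3 L ι₁) (c : SeesawCtx L),
      (thetaModelOf hHD hI h₁ (cmAbelianVarietyRealised_of_eigenbasis hHD hI h₃) (orientBitι L ι₁) (embOf hHD hI h₁ (cmAbelianVarietyRealised_of_eigenbasis hHD hI h₃)) (coverOf hHD hI h₁ (cmAbelianVarietyRealised_of_eigenbasis hHD hI h₃) hA) (wmOfInput W) (thetaOf _ (thetaClassInputOf _ (fun V c => thetaSpaceInputOf hHD hI h₁ (cmAbelianVarietyRealised_of_eigenbasis hHD hI h₃) S V c))) (d12Of μ) (d34Of μ)).GoodCtx ι₁ c → Module.finrank ℚ c.K = 6 →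
      Nonempty (((coreOf _ (embOf hHD hI h₁ (cmAbelianVarietyRealised_of_eigenbasis hHD hI h₃)) (coverOf hHD hI h₁ (cmAbelianVarietyRealised_of_eigenbasis hHD hI h₃) hA) (wmOfInput W) (thetaOf _ (thetaClassInputOf _ (fun V c => thetaSpaceInputOf hHD hI h₁ (cmAbelianVarietyRealised_of_eigenbasis hHD hI h₃) S V c)))).toCore (orientBitι L ι₁)).HypSmoothCore12
        (((coreOf _ (embOf hHD hI h₁ (cmAbelianVarietyRealised_of_eigenbasis hHD hI h₃)) (coverOf hHD hI h₁ (cmAbelianVarietyRealised_of_eigenbasis hHD hI h₃) hA) (wmOfInput W) (thetaOf _ (thetaClassInputOf _ (fun V c => thetaSpaceInputOf hHD hI h₁ (cmAbelianVarietyRealised_of_eigenbasis hHD hI h₃) S V c)))).toCore (orientBitι L ι₁)).side12 (d12Of μ)) (((coreOf _ (embOf hHD hI h₁ (cmAbelianVarietyRealised_of_eigenbasis hHD hI h₃)) (coverOf hHD hI h₁ (cmAbelianVarietyRealised_of_eigenbasis hHD hI h₃) hA) (wmOfInput W) (thetaOf _ (thetaClassInputOf _ (fun V c => thetaSpaceInputOf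 hHD hI h₁ (cmAbelianVarietyRealised_of_eigenbasis hHD hI h₃) S V c)))).toCore (orientBitι L ι₁)).side34 (d34Of μ))
        ((((coreOf _ (embOf hHD hI h₁ (cmAbelianVarietyRealised_of_eigenbasis hHD hI h₃)) (coverOf hHD hI h₁ (cmAbelianVarietyRealised_of_eigenbasis hHD hI h₃) hA) (wmOfInput W) (thetaOf _ (thetaClassInputOf _ (fun V c => thetaSpaceInputOf hHD hI h₁ (cmAbelianVarietyRealised_of_eigenbasis hHD hI h₃) S V c)))).toCore (orientBitι L ι₁)).analyticKM (((coreOf _ (embOf hHD hI h₁ (cmAbelianVarietyRealised_of_eigenbasis hHD hI h₃)) (coverOf hHD hI h₁ (cmAbelianVarietyRealised_of_eigenbasis hHD hI h₃) hA) (wmOfInput W) (thetaOf _ (thetaClassInputOf _ (fun V c => thetaSpaceInputOf hHD hI h₁ (cmAbelianVarietyRealised_of_eigenbasis hHD hI h₃) S V c)))).toCore (orientBitι L ι₁)).side12 (d12Of μ))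
          (((coreOf _ (embOf hHD hI h₁ (cmAbelianVarietyRealised_of_eigenbasis hHD hI h₃)) (coverOf hHD hI h₁ (cmAbelianVarietyRealised_of_eigenbasis hHD hI h₃) hA) (wmOfInput W) (thetaOf _ (thetaClassInputOf _ (fun V c => thetaSpaceInputOf hHD hI h₁ (cmAbelianVarietyRealised_of_eigenbasis hHD hI h₃) S V c)))).toCore (orientBitι L ι₁)).side34 (d34Of μ))).toAnalytic) V c (ℓ := linOfInput W V c)))
    (hyp34 : ∀ {L : CMField} {ι₁ : L →+* ℂ} (V : HermSpace3 L ι₁) (c : SeesawCtx L),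
      (thetaModelOf hHD hI h₁ (cmAbelianVarietyRealised_of_eigenbasis hHD hI h₃) (orientBitι L ι₁) (embOf hHD hI h₁ (cmAbelianVarietyRealised_of_eigenbasis hHD hI h₃)) (coverOf hHD hI h₁ (cmAbelianVarietyRealised_of_eigenbasis hHD hI h₃) hA) (wmOfInput W) (thetaOf _ (thetaClassInputOf _ (fun V c => thetaSpaceInputOf hHD hI h₁ (cmAbelianVarietyRealised_of_eigenbasis hHD hI h₃) S V c))) (d12Of μ) (d34Of μ)).GoodCtx ι₁ c → Module.finrank ℚ c.K = 6 →
      Nonempty (((coreOf _ (embOf hHD hI h₁ (cmAbelianVarietyRealised_of_eigenbasis hHD hI h₃)) (coverOf hHD hI h₁ (cmAbelianVarietyRealised_of_eigenbasis hHD hI h₃) hA) (wmOfInput W) (thetaOf _ (thetaClassInputOf _ (fun V c => thetaSpaceInputOf hHD hI h₁ (cmAbelianVarietyRealised_of_eigenbasis hHD hI h₃) S V c)))).toCore (orientBitι L ι₁)).HypSmoothCore34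
        (((coreOf _ (embOf hHD hI h₁ (cmAbelianVarietyRealised_of_eigenbasis hHD hI h₃)) (coverOf hHD hI h₁ (cmAbelianVarietyRealised_of_eigenbasis hHD hI h₃) hA) (wmOfInput W) (thetaOf _ (thetaClassInputOf _ (fun V c => thetaSpaceInputOf hHD hI h₁ (cmAbelianVarietyRealised_of_eigenbasis hHD hI h₃) S V c)))).toCore (orientBitι L ι₁)).side12 (d12Of μ)) (((coreOf _ (embOf hHD hI h₁ (cmAbelianVarietyRealised_of_eigenbasis hHD hI h₃)) (coverOf hHD hI h₁ (cmAbelianVarietyRealised_of_eigenbasis hHD hI h₃) hA) (wmOfInput W) (thetaOf _ (thetaClassInputOf _ (fun V c => thetaSpaceInputOf hHD hI h₁ (cmAbelianVarietyRealised_of_eigenbasis hHD hI h₃) S V c)))).toCore (orientBitι L ι₁)).side34 (d34Of μ))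
        ((((coreOf _ (embOf hHD hI h₁ (cmAbelianVarietyRealised_of_eigenbasis hHD hI h₃)) (coverOf hHD hI h₁ (cmAbelianVarietyRealised_of_eigenbasis hHD hI h₃) hA) (wmOfInput W) (thetaOf _ (thetaClassInputOf _ (fun V c => thetaSpaceInputOf hHD hI h₁ (cmAbelianVarietyRealised_of_eigenbasis hHD hI h₃) S V c)))).toCore (orientBitι L ι₁)).analyticKM (((coreOf _ (embOf hHD hI h₁ (cmAbelianVarietyRealised_of_eigenbasis hHD hI h₃)) (coverOf hHD hI h₁ (cmAbelianVarietyRealised_of_eigenbasis hHD hI h₃) hA) (wmOfInput W) (thetaOf _ (thetaClassInputOf _ (fun V c => thetaSpaceInputOf hHD hI h₁ (cmAbelianVarietyRealised_of_eigenbasis hHD hI h₃) S V c)))).toCore (orientBitι L ι₁)).side12 (d12Of μ))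
          (((coreOf _ (embOf hHD hI h₁ (cmAbelianVarietyRealised_of_eigenbasis hHD hI h₃)) (coverOf hHD hI h₁ (cmAbelianVarietyRealised_of_eigenbasis hHD hI h₃) hA) (wmOfInput W) (thetaOf _ (thetaClassInputOf _ (fun V c => thetaSpaceInputOf hHD hI h₁ (cmAbelianVarietyRealised_of_eigenbasis hHD hI h₃) S V c)))).toCore (orientBitι L ι₁)).side34 (d34Of μ))).toAnalytic) V c (ℓ := linOfInput W V c))) :
     (picardCMUniverse hHD hI h₁ (cmAbelianVarietyRealised_of_eigenbasis hHD hI h₃)).PerL :=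
  perL_picardCM_r21AEO hHD hI h₁ h₃ orientBitι hA W S μ hR hΘ C hT hpd hk gen12 real34 hyp12 hyp34

end Model

end HodgeCM
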